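import Literature.Geometry.Lorentzian.LeviCivita
import Literature.Geometry.Riemannian.IsotropicCurvature
import HarnessLib

/-!
# The Schouten, Weyl and Bach tensors of a metric; Bach-flat metrics

Definitions (real, with bodies; NO named facts in this file — it is meant to sit in the import
cone of routes: it imports only `Lorentzian/LeviCivita`, `Riemannian/IsotropicCurvature` and
Mathlib) of the **Bach tensor** of a pseudo-Riemannian metric and of **Bach-flatness**
(definition request `defn-IsBachFlat`, route `SmoothPoincare4/BachCriticalElement`: conjecture R
"Bach-flat + `scal > 0` on a smooth homotopy `4`-sphere ⇒ locally conformally flat", and the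
Bach-flat limit objects of the Chang–Qing–Yang bubble tree), over the metric vocabulary of
`Literature/Geometry/{Lorentzian,Riemannian}`: a `C^n` metric
`g : PseudoRiemannianMetric I n E (TangentSpace I : M → Type _)` with Levi-Civita connection
`g.leviCivita` (standing instance hypothesis `[g.HasLeviCivita]`, `LeviCivita.lean`), covariant
curvature tensor `Rm(X,Y,Z,W) = g(R(X,Y)Z, W)` (`g.curvatureForm g.leviCivita`,
`IsotropicCurvature.lean`), Ricci tensor `g.ricci`, scalar curvature `g.scalarCurvature`, metric
trace `g.trace`, musical isomorphism `g.sharp`, and the covariant derivative `g.covDeriv₂` of a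
field of bilinear forms (`LeviCivita.lean`). Throughout `m = dim M = finrank ℝ E`.

* `g.schoutenTensor x` — the **Schouten tensor** `P = (1/(m-2)) (Ric - S/(2(m-1)) g)` as a
  bilinear form on `T_x M` (Lee 2018, p. 215; Besse 1987, 1.116: `R = W + P ⊙ g` with
  `P = (s/(2n(n-1))) g + (1/(n-2)) z`, `z = r - (s/n) g`; in dimension `4`, `P = ½ A` with
  `A = Ric - (R/6) g` the "Weyl–Schouten tensor" of Chang–Gursky–Yang 2003, §1, (1.0)), and
  `g.schoutenCLM x` the same as a continuous bilinear form (finite dimension);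
* `g.weyl x X Y Z V` — the **Weyl tensor** `W = Rm - P ⊙ g` as a `4`-slot function on `T_x M`,
  written out as
  `Rm(X,Y,Z,V) - (1/(m-2))(Ric(X,V)g(Y,Z) + Ric(Y,Z)g(X,V) - Ric(X,Z)g(Y,V) - Ric(Y,V)g(X,Z))
   + (S/((m-1)(m-2)))(g(X,V)g(Y,Z) - g(X,Z)g(Y,V))`
  (Besse 1987, 1.110 and (1.116)–1.117, Kulkarni–Nomizu product `⊙` in the slot convention of this
  tree; Chang–Gursky–Yang 2003, (0.1)/(1.0): `Riem = W + ½ A ⊙ g`). This is, letter for letter,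
  the formula of `g.weylFrame` (`WeylEnergy.lean`) with `δ_{jk}` replaced by `g(eⱼ,e_k)` and the body
  of `g.weylTensor` (`ChangGurskyYangProofs.lean`, where `weylFrame_eq_weylTensor` is proved), so
  `g.weyl = g.weylTensor` holds by `rfl`; neither file is imported here, to keep the import cone of
  this definition free of the Weyl-energy and Chang–Gursky–Yang material (cone hygiene, below);
* `g.covDeriv₃ K x` — the covariant derivative `∇K` of a field `K` of continuous TRILINEAR forms,
  `covDeriv₃ g K x X₀ Y₀ Z₀ V₀ = (∇_{V₀} K)(X₀, Y₀, Z₀)` (derivative slot last), the verbatim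
  three-slot analogue of `g.covDeriv₂` of `LeviCivita.lean` (same "unique multilinear map
  representing the classical formula `V(K(X,Y,Z)) - K(∇_V X,Y,Z) - K(X,∇_V Y,Z) - K(X,Y,∇_V Z)` on
  extended vectors, else `0`" construction; O'Neill 1983, Def. 3.10 and Prop. 3.18);
* `g.schoutenCovDeriv x = ∇P` (`= g.covDeriv₂ P`, `(∇P)(X,Y,Z) = (∇_Z P)(X,Y) = P_{XY;Z}`) and
  `g.schoutenCovDeriv₂ x = ∇²P` (`= g.covDeriv₃ (∇P)`, `(∇²P)(X,Y,Z,V) = (∇_V ∇P)(X,Y,Z) = P_{XY;ZV}`);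
* `g.bachTensor x X Y` — the **Bach tensor**
  `B(X,Y) = g^{kl} P_{XY;kl} - g^{kl} P_{Yk;Xl} + P^{kl} W_{kXYl}`, i.e.
  `B_{ij} = (ΔP)_{ij} - ∇^k ∇_i P_{jk} + P^{kl} W_{kijl}`, the three metric traces of `∇²P`, `∇²P` and
  `W(·, X, Y, P♯·)` (`g.schoutenLaplacianForm`, `g.schoutenMixedForm`, `g.schoutenWeylForm`);
  a plain function of `(X, Y)` like `g.curvatureForm` (bilinearity is not packaged);
* `g.IsBachFlat` — **`g` is Bach-flat**: `B ≡ 0` (Chang–Gursky–Yang 2003, p. 2: "The gradient of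
  this functional [`g ↦ ∫|W|² dvol`] is called the Bach tensor, and we will say that critical metrics
  are Bach-flat"; Besse 1987, 4.76–4.77).

## The formula, and why it is Chang–Gursky–Yang's (0.7)

Chang–Gursky–Yang 2003, (0.7) (arXiv:math/0309287, p. 2) print, in dimension `4` and local
coordinates, `B_{ij} = ∇^k ∇^l W_{kijl} + ½ R^{kl} W_{kijl}`; Cao–Chen 2013, §2, print for `n ≥ 4`
`B_{ij} = (1/(n-3)) ∇^k∇^l W_{ikjl} + (1/(n-2)) R_{kl} W_i{}^k{}_j{}^l` and, "by (2.2)"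
(`C_{ijk} = -((n-2)/(n-3)) ∇_l W_{ijkl}`, the contracted second Bianchi identity),
"(2.3) `B_{ij} = (1/(n-2)) (∇_k C_{kij} + R_{kl} W_i{}^k{}_j{}^l)`" with `A_{ij} = R_{ij} - R/(2(n-1)) g_{ij}`
(their (2.1), `= (n-2) P`) and `C_{ijk} = ∇_i A_{jk} - ∇_j A_{ik}`. Written out, (2.3) is
`B_{ij} = ΔP_{ij} - ∇^k∇_i P_{kj} + (1/(n-2)) R^{kl} W_{ikjl}` in Cao–Chen's curvature convention
(`Ric_{jl} = g^{ik} R_{ijkl}`, visible in their formula for `W`), whose `R_{ijkl}` is MINUS the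
`Rm(eᵢ,eⱼ,e_k,e_l)` of this tree (`Ric(Y,Z) = tr (v ↦ R(v,Y)Z) = Σᵢ Rm(eᵢ,Y,Z,eᵢ)`, i.e.
`Ric_{jk} = g^{il} R_{ijkl}`, Lee's convention; `LeviCivita.lean`); the two conventions have the same
`Ric`, `S`, `P`, and opposite `Rm`, `W`. Hence, in the conventions of this tree,
`B_{ij} = ΔP_{ij} - ∇^k∇_i P_{jk} + (1/(m-2)) R^{kl} W_{kijl}`, and since `W` is totally trace-free
(`g^{kl} W_{kijl} = 0`) and `Ric = (m-2) P + (tr P) g`, the last term is `P^{kl} W_{kijl}`: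

  `B_{ij} = P_{ij;k}{}^k - P_{jk;i}{}^k + P^{kl} W_{kijl}`            (definition used here, any `m`)
        `= (1/(m-3)) ∇^k∇^l W_{kijl} + (1/(m-2)) R^{kl} W_{kijl}`      (`m ≥ 4`, contracted Bianchi),

which for `m = 4` is (0.7) read in the slot convention of this tree. (Directly: the contracted
second Bianchi identity `∇^i R_{ijkl} = Ric_{jk;l} - Ric_{jl;k}` gives
`∇^i W_{ijkl} = (m-3)(P_{jk;l} - P_{jl;k})` (Lee 2018, Prop. 7.32, (7.50): `tr_g(∇W) = (n-3)C`), whence `∇^l W_{kijl} = (m-3)(P_{ij;k} - P_{jk;i})` by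
`W_{kijl} = W_{ljik}`, and `∇^k∇^l W_{kijl} = (m-3)(ΔP_{ij} - ∇^k∇_i P_{jk})`. Chang–Gursky–Yang's own
(3.13), `∇_m W_{ijml} = ½(dA)_{ijl}`, `(dA)_{ijk} = ∇_i A_{jk} - ∇_j A_{ik}`, shows that they use the
`R_{ijij} > 0` convention, so their `B` is `-1` times the tensor defined here; Derdziński's form
quoted there, "[De, (23)]: `0 = ∇_k∇_l W_{iklj} - ½ W_{ikjl} A_{kl}`", and Besse's
`B = -2 δ^D D^* W - 2 W̊ r` (4.77) differ from (0.7) by further nonzero constant factors.) The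
PREDICATE `B = 0` — Bach-flatness, the only notion requested — is the same for all of them. The
form through `P` is chosen because it needs covariant derivatives of `2`- and `3`-slot tensor
fields only (`covDeriv₂` exists, `covDeriv₃` is its copy), instead of second covariant derivatives
of the `4`-slot field `W`; by the Ricci identity `∇^k∇_i P_{jk}` is symmetric in `i, j`, so `B` is
symmetric and also equals `∇^k C_{ijk} + P^{kl} W_{kijl}` with the Cotton tensor
`C_{ijk} = P_{ij;k} - P_{ik;j}` (Lee 2018, (7.49)); in dimension `3` (where `W = 0`) the definition
reads `B = div C`. None of these identities is needed for, or proved in, this file.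

## Conventions pinned

* `R(X,Y)Z = ∇_X ∇_Y Z - ∇_Y ∇_X Z - ∇_{[X,Y]} Z`, `Rm(X,Y,Z,W) = g(R(X,Y)Z,W)`,
  `Ric(Y,Z) = tr (v ↦ R(v,Y)Z)`, `S = tr_g Ric` (`LeviCivita.lean`, `IsotropicCurvature.lean`);
  `(∇k)(X,Y,Z) = (∇_Z k)(X,Y)` (derivative slot last, `covDeriv₂`), and likewise for `covDeriv₃`;
  `T_{;kl} = ∇_l ∇_k T` (first `k`, then `l`), so `(∇²P)(X,Y,Z,V) = P_{XY;ZV}`.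
* Junk values: `1/(m-2) = 0` for `m = 2` (Lean's `x/0 = 0`; the Schouten tensor needs `m ≥ 3`);
  `covDeriv₂`, `covDeriv₃` are `0` where the field is not differentiable (never the case for the
  Schouten tensor of a smooth metric, a theorem not needed here); `g.sharp`, `g.trace` are the honest
  linear-algebra operations of `PseudoRiemannianMetric.lean` (finite-dimensional fibres).
* Stated for pseudo-Riemannian `g` of any dimension (the requester's case: Riemannian, `m = 4`,
  `n = ∞`); Riemannian-ness and the dimension are hypotheses of the theorems about Bach-flat metrics,
  not part of the predicate.

## Cone hygiene

This file declares no `def … : Prop` other than the predicate `IsBachFlat g` (explicit binder) and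
imports only `LeviCivita.lean` / `IsotropicCurvature.lean`, exactly the cone of the route file
`Summits/SmoothPoincare4/SmoothPoincare4/Theses/BachCriticalElement.lean`; named FACTS about
Bach-flat metrics (Chang–Gursky–Yang 2003 Thm. C, Chang–Qing–Yang 2007 Thms. A/B, Tian–Viaclovsky)
belong in separate files.

## What is proved here (API) and what is NOT

Proved: unfolding lemmas; `W = Rm - P ⊙ g` (`weyl_eq_curvatureForm_sub`); the dimension-`4` forms
`P = ½(Ric - (S/6) g)` and
`W = Rm - ½(Ric_{il}g_{jk} + Ric_{jk}g_{il} - Ric_{ik}g_{jl} - Ric_{jl}g_{ik}) + (S/6)(g_{il}g_{jk} - g_{ik}g_{jl})`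
(the formula of `weylFrame_fin_four`, Chang–Gursky–Yang (0.1)); antisymmetry of `W` in its first
pair and linearity in its first and last slots; `∇` of the zero field of trilinear forms is zero
(`covDeriv₃_zero`); and the sanity theorem `isBachFlat_of_isFlat`: a metric whose Levi-Civita
connection is flat (`Rm ≡ 0`, e.g. a constant metric on a vector space, `MinkowskiFlat.lean`) is
Bach-flat. NOT here (theorems
wanted later by the route, not part of the definition): Einstein ⇒ Bach-flat (`∇P = 0` and
trace-freeness of `W`), locally conformally flat ⇒ Bach-flat, conformal covariance
`B(e^{2u}g) = e^{-2u} B(g)` in dimension `4`, symmetry, trace- and divergence-freeness of `B`, the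
variational characterisation `B = ∓¼ grad (g ↦ ∫|W|² dV)` (Besse 4.76–4.77), the equality with
(0.7) via the contracted Bianchi identity, and frame independence statements. Mathlib has no
Schouten/Weyl/Cotton/Bach tensor (searched `Schouten`, `Weyl`, `Cotton`, `Bach` in
`Mathlib/Geometry`, `Mathlib/Analysis/InnerProductSpace`).

## References

* S.-Y. A. Chang, M. J. Gursky, P. C. Yang, *A conformally invariant sphere theorem in four
  dimensions*, Publ. Math. IHÉS 98 (2003) 105–143 (arXiv:math/0309287): p. 2 (Bach-flat = critical
  for `∫|W|²`), (0.7) (the Bach tensor), §1 (1.0) (`A = Ric - (R/6)g`, `Riem = W + ½ A ⊙ g`), (3.13)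
  and the display before (3.24) ([De, (23)]). [ChangGurskyYang2003]
* H.-D. Cao, Q. Chen, *On Bach-flat gradient shrinking Ricci solitons*, Duke Math. J. 162 (2013)
  1149–1169 (arXiv:1105.3163), §2: (2.1) (Schouten tensor), the formulas for `W` and `C`, (2.2)
  (`C = -((n-2)/(n-3)) div W`), (2.3) (`B` through the Cotton tensor). [CaoChen2013]
* A. L. Besse, *Einstein Manifolds* (1987), 1.110 (Kulkarni–Nomizu product), (1.116)–1.117 (Weyl
  and Schouten parts of `R`), 4.76–4.78, p. 135 (the Bach tensor as the gradient of `SW = ∫|W|²`,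
  (4.77) `B = -2δ^D D^*W - 2W̊r`, conformally Einstein and half-conformally-flat metrics are
  Bach-flat). [Besse1987]
* J. M. Lee, *Introduction to Riemannian Manifolds*, 2nd ed. (2018), Ch. 7 (the curvature
  conventions of this tree): (7.37) (the Kulkarni–Nomizu product — verbatim the slot convention used
  here; Besse's 1.110 has slots `(x,y,z,t)` ↦ `(x,y,t,z)`), p. 215 and Prop. 7.24 (Schouten tensor
  `P`, Weyl tensor `W = Rm - P ⊙ g = Rm - (1/(n-2)) Rc ⊙ g + (S/(2(n-1)(n-2))) g ⊙ g`, trace-free),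
  (7.49) (Cotton tensor `C_{ijk} = P_{ij;k} - P_{ik;j}`), Prop. 7.32, (7.50) (`tr_g(∇W) = (n-3) C`,
  trace on the first and last indices — the contracted Bianchi identity for `W` used above),
  Prop. 4.15 ff. (covariant derivatives of tensor fields). [Lee2018]
* B. O'Neill, *Semi-Riemannian geometry* (1983), Ch. 3, Def. 3.9–3.10 and Prop. 3.18 (tensor
  derivations and the covariant differential), pp. 60–61 (metric contraction). [ONeill1983]
-/

noncomputable section

open Bundle FiberBundle
open scoped Manifold ContDiff Topology

namespace Literature.Geometry.Riemannian

open Literature.Geometry.Lorentzian (PseudoRiemannianMetric)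
open Literature.Geometry.Lorentzian.PseudoRiemannianMetric


variable {E : Type*} [NormedAddCommGroup E] [NormedSpace ℝ E] {H : Type*} [TopologicalSpace H]
  {I : ModelWithCorners ℝ E H} {M : Type*} [TopologicalSpace M] [ChartedSpace H M]
  [IsManifold I ∞ M] {n : ℕ∞ω} {x : M}

variable (g : PseudoRiemannianMetric I n E (TangentSpace I : M → Type _))

/-! ### The covariant derivative of a field of trilinear forms -/

section CovDeriv

variable [g.HasLeviCivita]

/-- The covariant derivative of a field `K` of trilinear forms as a bare operation on vector
fields: `covDeriv₃Aux g K X Y Z V x = (∇_V K)(X,Y,Z)(x)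
  = V(K(X,Y,Z))(x) - K_x(∇_V X, Y, Z) - K_x(X, ∇_V Y, Z) - K_x(X, Y, ∇_V Z)`
(derivative of the scalar function via Mathlib's `mvfderiv`, `∇ = g.leviCivita`). The verbatim
three-slot analogue of `covDeriv₂Aux` (`LeviCivita.lean`); prefer the tensor `covDeriv₃`.
O'Neill 1983, Ch. 3, Def. 3.9–3.10 and Prop. 3.18 (tensor derivations, covariant differential);
Lee 2018, Prop. 4.15. [cite: ONeill1983, Ch. 3, Def. 3.9–3.10 and Prop. 3.18] -/
def _root_.Literature.Geometry.Lorentzian.PseudoRiemannianMetric.covDeriv₃Aux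
    (K : Π x : M, TangentSpace I x →L[ℝ] TangentSpace I x →L[ℝ] TangentSpace I x →L[ℝ] ℝ)
    (X Y Z V : Π x : M, TangentSpace I x) (x : M) : ℝ :=
  mvfderiv I (fun y ↦ K y (X y) (Y y) (Z y)) x (V x)
    - K x (g.leviCivita X x (V x)) (Y x) (Z x) - K x (X x) (g.leviCivita Y x (V x)) (Z x)
    - K x (X x) (Y x) (g.leviCivita Z x (V x))

open scoped Classical in
/-- **The covariant derivative `∇K` of a field of continuous trilinear forms** `K` on `TM` at
`x`, as a `4`-linear map with `covDeriv₃ g K x X₀ Y₀ Z₀ V₀ = (∇_{V₀} K)(X₀, Y₀, Z₀)` (derivative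
slot LAST, as for `covDeriv₂`): the unique such map agreeing with `covDeriv₃Aux g K` on the
extended (`FiberBundle.extend`) tangent vectors when one exists (e.g. when `K` is differentiable at
`x`), and the junk value `0` otherwise — the construction of `g.covDeriv₂` (`LeviCivita.lean`) with
one more slot. The value is an algebraic multilinear map (`→ₗ`, automatically continuous on the
finite-dimensional tangent spaces this file works with; Mathlib's topology on iterated spaces of
continuous linear maps stops at three slots over a general topological vector space). Used here for
`∇²P = ∇(∇P)`. O'Neill 1983, Ch. 3, Def. 3.10 and Prop. 3.18;
Lee 2018, Prop. 4.15–4.17. [cite: ONeill1983, Ch. 3, Def. 3.10 and Prop. 3.18] -/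
def _root_.Literature.Geometry.Lorentzian.PseudoRiemannianMetric.covDeriv₃
    (K : Π x : M, TangentSpace I x →L[ℝ] TangentSpace I x →L[ℝ] TangentSpace I x →L[ℝ] ℝ)
    (x : M) :
    TangentSpace I x →ₗ[ℝ] TangentSpace I x →ₗ[ℝ] TangentSpace I x →ₗ[ℝ] TangentSpace I x →ₗ[ℝ] ℝ :=
  if h : ∃ Q : TangentSpace I x →ₗ[ℝ] TangentSpace I x →ₗ[ℝ] TangentSpace I x →ₗ[ℝ]
      TangentSpace I x →ₗ[ℝ] ℝ, ∀ X₀ Y₀ Z₀ V₀ : TangentSpace I x,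
        Q X₀ Y₀ Z₀ V₀ =
          g.covDeriv₃Aux K (extend E X₀) (extend E Y₀) (extend E Z₀) (extend E V₀) x
  then h.choose else 0

/-- Defining property of `covDeriv₃`: when the classical formula on extended vectors is
represented by a `4`-linear map, `covDeriv₃` is such a map. [folklore] -/
theorem _root_.Literature.Geometry.Lorentzian.PseudoRiemannianMetric.covDeriv₃_apply_of_exists
    {K : Π x : M, TangentSpace I x →L[ℝ] TangentSpace I x →L[ℝ] TangentSpace I x →L[ℝ] ℝ}
    (h : ∃ Q : TangentSpace I x →ₗ[ℝ] TangentSpace I x →ₗ[ℝ] TangentSpace I x →ₗ[ℝ]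
      TangentSpace I x →ₗ[ℝ] ℝ, ∀ X₀ Y₀ Z₀ V₀ : TangentSpace I x,
        Q X₀ Y₀ Z₀ V₀ =
          g.covDeriv₃Aux K (extend E X₀) (extend E Y₀) (extend E Z₀) (extend E V₀) x)
    (X₀ Y₀ Z₀ V₀ : TangentSpace I x) :
    g.covDeriv₃ K x X₀ Y₀ Z₀ V₀ =
      g.covDeriv₃Aux K (extend E X₀) (extend E Y₀) (extend E Z₀) (extend E V₀) x := by
  unfold covDeriv₃
  rw [dif_pos h]
  exact h.choose_spec X₀ Y₀ Z₀ V₀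

/-- Junk value of `covDeriv₃`: `0` when the classical formula is not represented by a `4`-linear
map at `x`. [folklore] -/
theorem _root_.Literature.Geometry.Lorentzian.PseudoRiemannianMetric.covDeriv₃_of_not_exists
    {K : Π x : M, TangentSpace I x →L[ℝ] TangentSpace I x →L[ℝ] TangentSpace I x →L[ℝ] ℝ}
    (h : ¬ ∃ Q : TangentSpace I x →ₗ[ℝ] TangentSpace I x →ₗ[ℝ] TangentSpace I x →ₗ[ℝ]
      TangentSpace I x →ₗ[ℝ] ℝ, ∀ X₀ Y₀ Z₀ V₀ : TangentSpace I x,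
        Q X₀ Y₀ Z₀ V₀ =
          g.covDeriv₃Aux K (extend E X₀) (extend E Y₀) (extend E Z₀) (extend E V₀) x) :
    g.covDeriv₃ K x = 0 := by
  unfold covDeriv₃
  rw [dif_neg h]

/-- The classical formula for the zero field of trilinear forms vanishes identically. [folklore] -/
@[simp]
theorem _root_.Literature.Geometry.Lorentzian.PseudoRiemannianMetric.covDeriv₃Aux_zero
    (X Y Z V : Π x : M, TangentSpace I x) (x : M) :
    g.covDeriv₃Aux (fun _ ↦ 0) X Y Z V x = 0 := by
  simp [covDeriv₃Aux, mvfderiv_const]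

/-- **`∇0 = 0`** for fields of trilinear forms: the covariant derivative of the zero field is
zero (the representing map exists — it is `0` — and is unique). [folklore] -/
@[simp]
theorem _root_.Literature.Geometry.Lorentzian.PseudoRiemannianMetric.covDeriv₃_zero (x : M) :
    g.covDeriv₃ (fun _ ↦ 0) x = 0 := by
  have h : ∃ Q : TangentSpace I x →ₗ[ℝ] TangentSpace I x →ₗ[ℝ] TangentSpace I x →ₗ[ℝ]
      TangentSpace I x →ₗ[ℝ] ℝ, ∀ X₀ Y₀ Z₀ V₀ : TangentSpace I x,
        Q X₀ Y₀ Z₀ V₀ = g.covDeriv₃Aux (fun _ ↦ 0) (extend E X₀) (extend E Y₀) (extend E Z₀)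
          (extend E V₀) x :=
    ⟨0, fun _ _ _ _ ↦ by simp⟩
  ext X₀ Y₀ Z₀ V₀
  rw [g.covDeriv₃_apply_of_exists h]
  simp

/-- The classical formula for the zero field of bilinear forms vanishes identically (private copy,
for general `n`, of the computation in `covDeriv₂_zero` of `InitialData.lean`, which is stated for
`n = ∞` and lives outside this file's import cone). [folklore] -/
private theorem covDeriv₂Aux_zero'
    (X Y Z : Π x : M, TangentSpace I x) (x : M) :
    g.covDeriv₂Aux (fun _ ↦ 0) X Y Z x = 0 := by
  simp [covDeriv₂Aux, mvfderiv_const]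

/-- **`∇0 = 0`** for fields of bilinear forms (`g.covDeriv₂` of `LeviCivita.lean`), any regularity
`n` (private; the public `covDeriv₂_zero` of `InitialData.lean` is the case `n = ∞`). [folklore] -/
private theorem covDeriv₂_zero' (x : M) :
    g.covDeriv₂ (fun _ ↦ 0) x = 0 := by
  have h : ∃ K : TangentSpace I x →L[ℝ] TangentSpace I x →L[ℝ] TangentSpace I x →L[ℝ] ℝ,
      ∀ X₀ Y₀ Z₀ : TangentSpace I x,
        K X₀ Y₀ Z₀ = g.covDeriv₂Aux (fun _ ↦ 0) (extend E X₀) (extend E Y₀) (extend E Z₀) x :=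
    ⟨0, fun _ _ _ ↦ by simp [covDeriv₂Aux_zero']⟩
  have h' : g.covDeriv₂ (fun _ ↦ 0) x = h.choose := by
    unfold covDeriv₂
    rw [dif_pos h]
  ext X₀ Y₀ Z₀
  rw [h', h.choose_spec X₀ Y₀ Z₀]
  simp [covDeriv₂Aux_zero']

end CovDeriv

/-! ### The Schouten tensor -/

section Schouten

variable [FiniteDimensional ℝ E] [g.HasLeviCivita]

/-- **The Schouten tensor** `P_x = (1/(m-2)) (Ric_x - (S(x)/(2(m-1))) g_x)` of `g` at `x`,
`m = dim M`, as a bilinear form on `T_x M`; `Rm = W + P ⊙ g` (Besse 1987, 1.116, where the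
`g`-part of `R` is `(s/(2n(n-1))) g + (1/(n-2)) z`, `z = r - (s/n)g`, which equals `P`; Lee 2018,
p. 215). In dimension `4`, `P = ½(Ric - (S/6) g) = ½ A` with `A` the Weyl–Schouten tensor of
Chang–Gursky–Yang 2003, (1.0); Cao–Chen's (2.1) is `A = (n-2) P`. Meaningful for `m ≥ 3` (for
`m ≤ 2` the coefficients are Lean's junk `x/0 = 0`). [cite: Besse1987, (1.116)] [cite: Lee2018, Ch. 7, p. 215] -/
def _root_.Literature.Geometry.Lorentzian.PseudoRiemannianMetric.schoutenTensor (x : M) :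
    LinearMap.BilinForm ℝ (TangentSpace I x) :=
  (1 / ((Module.finrank ℝ E : ℝ) - 2)) •
    (g.ricci x - (g.scalarCurvature x / (2 * ((Module.finrank ℝ E : ℝ) - 1))) • g.toBilinForm x)

/-- `P(X,Y) = (1/(m-2)) (Ric(X,Y) - (S/(2(m-1))) g(X,Y))`. [cite: Besse1987, (1.116)] -/
@[simp]
theorem _root_.Literature.Geometry.Lorentzian.PseudoRiemannianMetric.schoutenTensor_apply
    (X Y : TangentSpace I x) :
    g.schoutenTensor x X Y =
      1 / ((Module.finrank ℝ E : ℝ) - 2) *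
        (g.ricci x X Y - g.scalarCurvature x / (2 * ((Module.finrank ℝ E : ℝ) - 1)) * g.val x X Y) := by
  simp [schoutenTensor, LinearMap.smul_apply, LinearMap.sub_apply, smul_eq_mul]

/-- In dimension `4`: `P = ½ (Ric - (S/6) g)` (`= ½ A`, `A = Ric - (R/6) g`, Chang–Gursky–Yang 2003,
§1, (1.0)). [cite: ChangGurskyYang2003, §1, (1.0)] -/
theorem _root_.Literature.Geometry.Lorentzian.PseudoRiemannianMetric.schoutenTensor_apply_of_finrank_eq_four
    (h4 : Module.finrank ℝ E = 4) (X Y : TangentSpace I x) :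
    g.schoutenTensor x X Y = 1 / 2 * (g.ricci x X Y - g.scalarCurvature x / 6 * g.val x X Y) := by
  rw [schoutenTensor_apply, h4]
  norm_num

/-- The Schouten tensor is symmetric as soon as the Ricci tensor is (the latter is the named fact
`ricci_symm` of `LeviCivita.lean` for `C^2` metrics, hypothesis `hr`). [folklore] -/
theorem _root_.Literature.Geometry.Lorentzian.PseudoRiemannianMetric.schoutenTensor_symm
    (hr : (g.ricci x).IsSymm) : (g.schoutenTensor x).IsSymm :=
  ⟨fun X Y ↦ by rw [schoutenTensor_apply, schoutenTensor_apply, hr.eq X Y, g.symm x X Y]⟩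

/-- **The Schouten tensor as a continuous bilinear form** on `T_x M` (the algebraic
`g.schoutenTensor x` made continuous by finite dimension, as `ricciCLM` in `RicciSection.lean`);
this is the field fed to `g.covDeriv₂`. [cite: Besse1987, (1.116)] -/
def _root_.Literature.Geometry.Lorentzian.PseudoRiemannianMetric.schoutenCLM (x : M) :
    TangentSpace I x →L[ℝ] TangentSpace I x →L[ℝ] ℝ :=
  haveI : FiniteDimensional ℝ (TangentSpace I x) := ‹FiniteDimensional ℝ E›
  haveI : T2Space (TangentSpace I x) := inferInstanceAs (T2Space E)
  LinearMap.toContinuousLinearMap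
    ((LinearMap.toContinuousLinearMap :
        (TangentSpace I x →ₗ[ℝ] ℝ) ≃ₗ[ℝ] (TangentSpace I x →L[ℝ] ℝ)).toLinearMap ∘ₗ
      g.schoutenTensor x)

/-- `schoutenCLM` is the Schouten tensor. [folklore] -/
@[simp]
theorem _root_.Literature.Geometry.Lorentzian.PseudoRiemannianMetric.schoutenCLM_apply
    (X Y : TangentSpace I x) : g.schoutenCLM x X Y = g.schoutenTensor x X Y :=
  rfl

end Schouten

/-! ### The Weyl tensor -/

section Weyl

variable [FiniteDimensional ℝ E] [g.HasLeviCivita]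

/-- **The Weyl tensor `W_x(X,Y,Z,V)` of `g` at `x`**, `m = dim M`:
`W(X,Y,Z,V) = Rm(X,Y,Z,V) - (1/(m-2)) (Ric(X,V)g(Y,Z) + Ric(Y,Z)g(X,V) - Ric(X,Z)g(Y,V) - Ric(Y,V)g(X,Z))
  + (S/((m-1)(m-2))) (g(X,V)g(Y,Z) - g(X,Z)g(Y,V))`,
i.e. the Weyl part `W = Rm - P ⊙ g` of the decomposition of the curvature tensor
(`weyl_eq_curvatureForm_sub`; `Rm = g.curvatureForm g.leviCivita`, `P` the Schouten tensor, `⊙`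
the Kulkarni–Nomizu product in the slot convention of this tree,
`(h ⊙ k)(X,Y,Z,V) = h(X,V)k(Y,Z) + h(Y,Z)k(X,V) - h(X,Z)k(Y,V) - h(Y,V)k(X,Z)`). Besse 1987, 1.110
and (1.116)–1.117; Lee 2018, p. 215 and Prop. 7.24; in dimension `4` Chang–Gursky–Yang 2003, (0.1)/(1.0),
`Riem = W + ½ A ⊙ g`. The body is, letter for letter, that of `g.weylTensor`
(`ChangGurskyYangProofs.lean`) and the formula of `g.weylFrame` (`WeylEnergy.lean`) with
`δ_{jk} = g(eⱼ,e_k)`, so `g.weyl x = g.weylTensor x` is `rfl` and the components of `W` on a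
`g_x`-orthonormal basis are `weylFrame` (`weylFrame_eq_weylTensor` there); those files are not
imported (cone hygiene). Totally trace-free; `W = 0` for `m = 3`; meaningful for `m ≥ 3` (junk
coefficients `x/0 = 0` below). [cite: Besse1987, (1.116)–1.117] [cite: ChangGurskyYang2003, (0.1)] -/
def _root_.Literature.Geometry.Lorentzian.PseudoRiemannianMetric.weyl (x : M)
    (X Y Z V : TangentSpace I x) : ℝ :=
  g.curvatureForm g.leviCivita x X Y Z V -
    1 / ((Module.finrank ℝ E : ℝ) - 2) *
      (g.ricci x X V * g.val x Y Z + g.ricci x Y Z * g.val x X V -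
        g.ricci x X Z * g.val x Y V - g.ricci x Y V * g.val x X Z) +
    g.scalarCurvature x / (((Module.finrank ℝ E : ℝ) - 1) * ((Module.finrank ℝ E : ℝ) - 2)) *
      (g.val x X V * g.val x Y Z - g.val x X Z * g.val x Y V)

/-- Unfolding of the Weyl tensor. [cite: Besse1987, (1.116)] -/
theorem _root_.Literature.Geometry.Lorentzian.PseudoRiemannianMetric.weyl_apply (x : M)
    (X Y Z V : TangentSpace I x) :
    g.weyl x X Y Z V =
      g.curvatureForm g.leviCivita x X Y Z V -
        1 / ((Module.finrank ℝ E : ℝ) - 2) *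
          (g.ricci x X V * g.val x Y Z + g.ricci x Y Z * g.val x X V -
            g.ricci x X Z * g.val x Y V - g.ricci x Y V * g.val x X Z) +
        g.scalarCurvature x / (((Module.finrank ℝ E : ℝ) - 1) * ((Module.finrank ℝ E : ℝ) - 2)) *
          (g.val x X V * g.val x Y Z - g.val x X Z * g.val x Y V) :=
  rfl

/-- **`W = Rm - P ⊙ g`**: the Weyl tensor is the curvature tensor minus the Kulkarni–Nomizu
product of the Schouten tensor with the metric,
`W(X,Y,Z,V) = Rm(X,Y,Z,V) - (P(X,V)g(Y,Z) + P(Y,Z)g(X,V) - P(X,Z)g(Y,V) - P(Y,V)g(X,Z))`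
(Besse 1987, (1.116): `R = (s/(2n(n-1))) g ⊙ g + (1/(n-2)) z ⊙ g + W`; Lee 2018, p. 215). Valid for
every `m` (for `m ≤ 2` both correction terms are the junk `0`). [cite: Besse1987, (1.116)] -/
theorem _root_.Literature.Geometry.Lorentzian.PseudoRiemannianMetric.weyl_eq_curvatureForm_sub
    (x : M) (X Y Z V : TangentSpace I x) :
    g.weyl x X Y Z V =
      g.curvatureForm g.leviCivita x X Y Z V -
        (g.schoutenTensor x X V * g.val x Y Z + g.schoutenTensor x Y Z * g.val x X V -
          g.schoutenTensor x X Z * g.val x Y V - g.schoutenTensor x Y V * g.val x X Z) := by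
  have h2 : (2 * ((Module.finrank ℝ E : ℝ) - 1))⁻¹ = 2⁻¹ * ((Module.finrank ℝ E : ℝ) - 1)⁻¹ :=
    mul_inv _ _
  have h3 : (((Module.finrank ℝ E : ℝ) - 1) * ((Module.finrank ℝ E : ℝ) - 2))⁻¹ =
      ((Module.finrank ℝ E : ℝ) - 1)⁻¹ * ((Module.finrank ℝ E : ℝ) - 2)⁻¹ :=
    mul_inv _ _
  simp only [weyl_apply, schoutenTensor_apply, div_eq_mul_inv, h2, h3]
  ring

/-- **The Weyl tensor in dimension `4`**:
`W(X,Y,Z,V) = Rm(X,Y,Z,V) - ½ (Ric(X,V)g(Y,Z) + Ric(Y,Z)g(X,V) - Ric(X,Z)g(Y,V) - Ric(Y,V)g(X,Z))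
  + (S/6) (g(X,V)g(Y,Z) - g(X,Z)g(Y,V))`, i.e. `W = Riem - ½ E ⊙ g - (R/24) g ⊙ g` with
`E = Ric - ¼ R g` — the formula of `weylFrame_fin_four` (`WeylEnergy.lean`) with `δ` replaced by
`g`. [cite: ChangGurskyYang2003, (0.1)] -/
theorem _root_.Literature.Geometry.Lorentzian.PseudoRiemannianMetric.weyl_apply_of_finrank_eq_four
    (h4 : Module.finrank ℝ E = 4) (x : M) (X Y Z V : TangentSpace I x) :
    g.weyl x X Y Z V =
      g.curvatureForm g.leviCivita x X Y Z V -
        1 / 2 *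
          (g.ricci x X V * g.val x Y Z + g.ricci x Y Z * g.val x X V -
            g.ricci x X Z * g.val x Y V - g.ricci x Y V * g.val x X Z) +
        g.scalarCurvature x / 6 * (g.val x X V * g.val x Y Z - g.val x X Z * g.val x Y V) := by
  rw [weyl_apply, h4]
  norm_num

/-- `W` is antisymmetric in its first two slots (from `curvatureForm_antisymm` and the
antisymmetry of the correction terms). [cite: Besse1987, 1.108 and (1.116)] -/
theorem _root_.Literature.Geometry.Lorentzian.PseudoRiemannianMetric.weyl_antisymm (x : M)
    (X Y Z V : TangentSpace I x) :
    g.weyl x X Y Z V = - g.weyl x Y X Z V := by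
  rw [weyl_apply, weyl_apply, g.curvatureForm_antisymm g.leviCivita x X Y]
  ring

/-- `W` is additive in its first slot. [folklore] -/
theorem _root_.Literature.Geometry.Lorentzian.PseudoRiemannianMetric.weyl_add₁ (x : M)
    (X X' Y Z V : TangentSpace I x) :
    g.weyl x (X + X') Y Z V = g.weyl x X Y Z V + g.weyl x X' Y Z V := by
  simp only [weyl_apply, curvatureForm, map_add, _root_.add_apply, LinearMap.add_apply]
  ring

/-- `W` is homogeneous in its first slot. [folklore] -/
theorem _root_.Literature.Geometry.Lorentzian.PseudoRiemannianMetric.weyl_smul₁ (x : M)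
    (c : ℝ) (X Y Z V : TangentSpace I x) :
    g.weyl x (c • X) Y Z V = c * g.weyl x X Y Z V := by
  simp only [weyl_apply, curvatureForm, map_smul, _root_.smul_apply, LinearMap.smul_apply,
    smul_eq_mul]
  ring

/-- `W` is additive in its last slot. [folklore] -/
theorem _root_.Literature.Geometry.Lorentzian.PseudoRiemannianMetric.weyl_add₄ (x : M)
    (X Y Z V V' : TangentSpace I x) :
    g.weyl x X Y Z (V + V') = g.weyl x X Y Z V + g.weyl x X Y Z V' := by
  simp only [weyl_apply, curvatureForm, map_add]
  ring

/-- `W` is homogeneous in its last slot. [folklore] -/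
theorem _root_.Literature.Geometry.Lorentzian.PseudoRiemannianMetric.weyl_smul₄ (x : M)
    (c : ℝ) (X Y Z V : TangentSpace I x) :
    g.weyl x X Y Z (c • V) = c * g.weyl x X Y Z V := by
  simp only [weyl_apply, curvatureForm, map_smul, smul_eq_mul]
  ring

/-- At a point where the curvature tensor, the Ricci tensor and the scalar curvature vanish, the
Weyl tensor vanishes. [folklore] -/
theorem _root_.Literature.Geometry.Lorentzian.PseudoRiemannianMetric.weyl_eq_zero_of_curvature_eq_zero
    (hR : g.leviCivita.curvature x = 0) (hRic : g.ricci x = 0) (hS : g.scalarCurvature x = 0)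
    (X Y Z V : TangentSpace I x) : g.weyl x X Y Z V = 0 := by
  simp [weyl_apply, curvatureForm, hR, hRic, hS]

end Weyl

/-! ### Covariant derivatives of the Schouten tensor -/

section SchoutenDeriv

variable [FiniteDimensional ℝ E] [g.HasLeviCivita]

/-- **`∇P`**, the covariant derivative of the Schouten tensor at `x`, a continuous trilinear map
with `schoutenCovDeriv g x X₀ Y₀ Z₀ = (∇_{Z₀} P)(X₀, Y₀) = P_{X₀Y₀;Z₀}` (derivative slot last):
`g.covDeriv₂` (`LeviCivita.lean`) of the field `y ↦ g.schoutenCLM y`. The Cotton tensor is its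
antisymmetrisation `C(X,Y,Z) = (∇P)(X,Y,Z) - (∇P)(X,Z,Y)` (Lee 2018, (7.49); not defined here).
[cite: Lee2018, (7.49)] [cite: ONeill1983, Ch. 3, Prop. 3.18] -/
def _root_.Literature.Geometry.Lorentzian.PseudoRiemannianMetric.schoutenCovDeriv (x : M) :
    TangentSpace I x →L[ℝ] TangentSpace I x →L[ℝ] TangentSpace I x →L[ℝ] ℝ :=
  g.covDeriv₂ (fun y ↦ g.schoutenCLM y) x

/-- **`∇²P`**, the second covariant derivative of the Schouten tensor at `x`, a `4`-linear map
with `schoutenCovDeriv₂ g x X₀ Y₀ Z₀ V₀ = (∇_{V₀} ∇P)(X₀, Y₀, Z₀) = P_{X₀Y₀;Z₀V₀}`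
(`= (∇²_{V₀,Z₀} P)(X₀,Y₀)`; both derivative slots last, the second derivative in the last slot):
`g.covDeriv₃` of the field `y ↦ g.schoutenCovDeriv y`. [cite: ONeill1983, Ch. 3, Prop. 3.18] -/
def _root_.Literature.Geometry.Lorentzian.PseudoRiemannianMetric.schoutenCovDeriv₂ (x : M) :
    TangentSpace I x →ₗ[ℝ] TangentSpace I x →ₗ[ℝ] TangentSpace I x →ₗ[ℝ] TangentSpace I x →ₗ[ℝ] ℝ :=
  g.covDeriv₃ (fun y ↦ g.schoutenCovDeriv y) x

/-- Unfolding of `∇P`. [folklore] -/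
theorem _root_.Literature.Geometry.Lorentzian.PseudoRiemannianMetric.schoutenCovDeriv_def (x : M) :
    g.schoutenCovDeriv x = g.covDeriv₂ (fun y ↦ g.schoutenCLM y) x :=
  rfl

/-- Unfolding of `∇²P`. [folklore] -/
theorem _root_.Literature.Geometry.Lorentzian.PseudoRiemannianMetric.schoutenCovDeriv₂_def (x : M) :
    g.schoutenCovDeriv₂ x = g.covDeriv₃ (fun y ↦ g.schoutenCovDeriv y) x :=
  rfl

end SchoutenDeriv

/-! ### The Bach tensor and Bach-flat metrics -/

section Bach

variable [FiniteDimensional ℝ E] [g.HasLeviCivita]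

/-- The bilinear form `(Z, V) ↦ (∇²P)(X, Y, Z, V) = P_{XY;ZV}` on `T_x M`, whose metric trace
`g^{kl} P_{XY;kl} = (ΔP)(X,Y)` is the (rough) Laplacian of the Schouten tensor — the first term of
the Bach tensor. [cite: CaoChen2013, §2, (2.3)] -/
def _root_.Literature.Geometry.Lorentzian.PseudoRiemannianMetric.schoutenLaplacianForm (x : M)
    (X Y : TangentSpace I x) : LinearMap.BilinForm ℝ (TangentSpace I x) :=
  g.schoutenCovDeriv₂ x X Y

/-- The bilinear form `(Z, V) ↦ (∇²P)(Y, Z, X, V) = P_{YZ;XV}` on `T_x M`, whose metric trace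
`g^{kl} P_{Yk;Xl} = ∇^l ∇_X P(Y, e_l)` is the second term of the Bach tensor.
[cite: CaoChen2013, §2, (2.3)] -/
def _root_.Literature.Geometry.Lorentzian.PseudoRiemannianMetric.schoutenMixedForm (x : M)
    (X Y : TangentSpace I x) : LinearMap.BilinForm ℝ (TangentSpace I x) :=
  LinearMap.mk₂ ℝ (fun Z V ↦ g.schoutenCovDeriv₂ x Y Z X V)
    (fun Z Z' V ↦ by simp only [map_add, LinearMap.add_apply])
    (fun c Z V ↦ by simp only [map_smul, LinearMap.smul_apply, smul_eq_mul])
    (fun Z V V' ↦ by simp only [map_add])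
    (fun c Z V ↦ by simp only [map_smul, smul_eq_mul])

/-- The bilinear form `(U, V) ↦ W(U, X, Y, P♯V)` on `T_x M` (`P♯V = ♯(P(V,·))`, index raising by
`g.sharp`), whose metric trace is the full contraction `P^{kl} W_{kXYl}` of the Schouten tensor
against the first and last slots of the Weyl tensor — the third term of the Bach tensor
(`= (1/(m-2)) R^{kl} W_{kXYl}`, `W` being trace-free). [cite: CaoChen2013, §2, (2.3)] -/
def _root_.Literature.Geometry.Lorentzian.PseudoRiemannianMetric.schoutenWeylForm (x : M)
    (X Y : TangentSpace I x) : LinearMap.BilinForm ℝ (TangentSpace I x) :=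
  LinearMap.mk₂ ℝ (fun U V ↦ g.weyl x U X Y (g.sharp x (g.schoutenTensor x V)))
    (fun U U' V ↦ by rw [weyl_add₁])
    (fun c U V ↦ by rw [weyl_smul₁, smul_eq_mul])
    (fun U V V' ↦ by rw [map_add, map_add, weyl_add₄])
    (fun c U V ↦ by rw [map_smul, map_smul, weyl_smul₄, smul_eq_mul])

/-- Unfolding of `schoutenLaplacianForm`. [folklore] -/
@[simp]
theorem _root_.Literature.Geometry.Lorentzian.PseudoRiemannianMetric.schoutenLaplacianForm_apply
    (X Y Z V : TangentSpace I x) :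
    (g.schoutenLaplacianForm x X Y) Z V = g.schoutenCovDeriv₂ x X Y Z V :=
  rfl

/-- Unfolding of `schoutenMixedForm`. [folklore] -/
@[simp]
theorem _root_.Literature.Geometry.Lorentzian.PseudoRiemannianMetric.schoutenMixedForm_apply
    (X Y Z V : TangentSpace I x) :
    (g.schoutenMixedForm x X Y) Z V = g.schoutenCovDeriv₂ x Y Z X V :=
  rfl

/-- Unfolding of `schoutenWeylForm`. [folklore] -/
@[simp]
theorem _root_.Literature.Geometry.Lorentzian.PseudoRiemannianMetric.schoutenWeylForm_apply
    (X Y U V : TangentSpace I x) :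
    (g.schoutenWeylForm x X Y) U V = g.weyl x U X Y (g.sharp x (g.schoutenTensor x V)) :=
  rfl

/-- **The Bach tensor** of `g` at `x`,
`B(X,Y) = g^{kl} P_{XY;kl} - g^{kl} P_{Yk;Xl} + P^{kl} W_{kXYl}`, i.e.
`B_{ij} = (ΔP)_{ij} - ∇^k∇_i P_{jk} + P^{kl} W_{kijl}` with `P` the Schouten and `W` the Weyl tensor
(metric traces `g.trace` of the three bilinear forms above). This is Cao–Chen 2013, (2.3),
`B_{ij} = (1/(n-2))(∇_k C_{kij} + R_{kl} W_i{}^k{}_j{}^l)` (`A = (n-2)P`, `C_{ijk} = ∇_iA_{jk} - ∇_jA_{ik}`),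
transcribed into the curvature convention of this tree, and equals
`(1/(m-3)) ∇^k∇^l W_{kijl} + (1/(m-2)) R^{kl} W_{kijl}` for `m ≥ 4` by the contracted second Bianchi
identity `∇^l W_{kijl} = (m-3)(P_{ij;k} - P_{jk;i})` and the trace-freeness of `W` — for `m = 4`
the formula (0.7) of Chang–Gursky–Yang 2003, `B_{ij} = ∇^k∇^l W_{kijl} + ½ R^{kl} W_{kijl}` (their own
sign convention for `R` makes their `B` the negative of this one; Besse's (4.77)
`B = -2δ^D D^*W - 2W̊r` differs by a factor; the zero locus is the same). See the module docstring
for the derivation. In dimension `4`, `B` is `∓¼` the `L²`-gradient of `g ↦ ∫|W|² dV` (Besse 1987,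
4.76–4.77), symmetric, trace-free, divergence-free and conformally covariant (not proved here).
[cite: ChangGurskyYang2003, (0.7)] [cite: CaoChen2013, §2, (2.3)] [cite: Besse1987, 4.76–4.77] -/
def _root_.Literature.Geometry.Lorentzian.PseudoRiemannianMetric.bachTensor (x : M)
    (X Y : TangentSpace I x) : ℝ :=
  g.trace x (g.schoutenLaplacianForm x X Y) - g.trace x (g.schoutenMixedForm x X Y) +
    g.trace x (g.schoutenWeylForm x X Y)

/-- Unfolding of the Bach tensor into its three traces. [cite: CaoChen2013, §2, (2.3)] -/
theorem _root_.Literature.Geometry.Lorentzian.PseudoRiemannianMetric.bachTensor_apply (x : M)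
    (X Y : TangentSpace I x) :
    g.bachTensor x X Y =
      g.trace x (g.schoutenLaplacianForm x X Y) - g.trace x (g.schoutenMixedForm x X Y) +
        g.trace x (g.schoutenWeylForm x X Y) :=
  rfl

end Bach

section BachFlat

variable [FiniteDimensional ℝ E]

/-- **`g` is Bach-flat**: its Bach tensor vanishes at every point, `B ≡ 0` — in dimension `4`
exactly the critical points of the Weyl functional `g ↦ ∫_M |W_g|² dV_g` among compactly supported
variations (Chang–Gursky–Yang 2003, p. 2: "The gradient of this functional is called the Bach
tensor, and we will say that critical metrics are Bach-flat"; Besse 1987, 4.76–4.78: conformally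
Einstein metrics and half-conformally-flat metrics are Bach-flat). A parametrised predicate — the
metric `g` and its Levi-Civita hypothesis are explicit binders of the definition (not section
variables), as for `IsRicciFlat` (`Einstein.lean`) — with no Riemannian or dimension hypothesis
built in; it is not an assertion (there is no `IsBachFlat_holds`).
[cite: ChangGurskyYang2003, p. 2 and (0.7)] [cite: Besse1987, 4.76–4.77] -/
def _root_.Literature.Geometry.Lorentzian.PseudoRiemannianMetric.IsBachFlat
    (g : PseudoRiemannianMetric I n E (TangentSpace I : M → Type _)) [g.HasLeviCivita] : Prop :=
  ∀ (x : M) (X Y : TangentSpace I x), g.bachTensor x X Y = 0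

variable [g.HasLeviCivita]

/-- Bach-flatness unfolded. [cite: ChangGurskyYang2003, (0.7)] -/
theorem _root_.Literature.Geometry.Lorentzian.PseudoRiemannianMetric.isBachFlat_iff :
    g.IsBachFlat ↔ ∀ (x : M) (X Y : TangentSpace I x), g.bachTensor x X Y = 0 :=
  Iff.rfl

omit [g.HasLeviCivita] in
/-- The metric trace of the zero bilinear form vanishes (private copy of `trace_zero` of
`EinsteinProofs.lean`, outside this file's import cone). [folklore] -/
private theorem trace_zero' (x : M) : g.trace x 0 = 0 := by
  simp [PseudoRiemannianMetric.trace]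

/-- **Flat metrics are Bach-flat.** If the Levi-Civita connection of `g` is flat (`Rm ≡ 0`,
`CovariantDerivative.IsFlat`; e.g. a metric with constant components on a vector space,
`isFlat_leviCivita_of_val_eq_const` in `MinkowskiFlat.lean`), then `Ric ≡ 0`, `S ≡ 0`, so the
Schouten tensor field, its covariant derivatives `∇P`, `∇²P` and the Weyl tensor all vanish, and
`B ≡ 0`. (The degenerate case `W = 0`, `P = 0` of "locally conformally flat, or Einstein, implies
Bach-flat", Cao–Chen 2013, §1; Besse 1987, 4.78.) [cite: Besse1987, 4.78] -/
theorem _root_.Literature.Geometry.Lorentzian.PseudoRiemannianMetric.isBachFlat_of_isFlat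
    (h : g.leviCivita.IsFlat) : g.IsBachFlat := by
  have hR : ∀ y : M, g.leviCivita.curvature y = 0 := fun y ↦ congrFun h y
  have hRic : ∀ y : M, g.ricci y = 0 := fun y ↦
    CovariantDerivative.ricci_eq_zero_of_isFlat g.leviCivita h y
  have hS : ∀ y : M, g.scalarCurvature y = 0 := fun y ↦ by
    rw [scalarCurvature, hRic y, trace_zero']
  have hP : ∀ y : M, g.schoutenTensor y = 0 := fun y ↦ by
    ext X Y
    simp [schoutenTensor_apply, hRic y, hS y]
  have hPCLM : (fun y : M ↦ g.schoutenCLM y) = fun _ ↦ 0 := by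
    funext y
    ext X Y
    rw [schoutenCLM_apply, hP y]
    rfl
  have hDP : (fun y : M ↦ g.schoutenCovDeriv y) = fun _ ↦ 0 := by
    funext y
    rw [schoutenCovDeriv_def, hPCLM, covDeriv₂_zero']
  have hDDP : ∀ y : M, g.schoutenCovDeriv₂ y = 0 := fun y ↦ by
    rw [schoutenCovDeriv₂_def, hDP, covDeriv₃_zero]
  have hW : ∀ (y : M) (X Y Z W : TangentSpace I y), g.weyl y X Y Z W = 0 := fun y ↦
    g.weyl_eq_zero_of_curvature_eq_zero (hR y) (hRic y) (hS y)
  intro y X Y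
  have h₁ : g.schoutenLaplacianForm y X Y = 0 := by
    ext Z V
    simp [hDDP y]
  have h₂ : g.schoutenMixedForm y X Y = 0 := by
    ext Z V
    simp [hDDP y]
  have h₃ : g.schoutenWeylForm y X Y = 0 := by
    ext U V
    simp [hW y]
  rw [bachTensor_apply, h₁, h₂, h₃, trace_zero']
  simp

end BachFlat

end Literature.Geometry.Riemannian
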